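import Mathlib
import HarnessLib
import Summits.ResolutionOfSingularities.ResolutionOfSingularities.Theorems.WildQuotientsWildQuotientResolutionConductorOneFrameAway

/-!
# S2 brick F3c-5 — the FRAME of the conductor-𝟙 core: the SEAM `e_I : Γ(O_{i,I}) ≃+* M_I` and the transported
# generator `τ : M_I →ₐ[k] M_I` with the diagonal-Möbius laws

(crux stmt-ResolutionOfSingularities-15640 `WildQuotients.WildQuotientResolution`, line `Sketch`; chain w45c post-V5
programme S2, design `L/res-L1-w45c-lead-1/S2-DESIGN.md` §1/§5/§7, lead-1 F8 SIG `L/res-L1-w45c-lead-1/stubs/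
ConductorOneF8Sig.lean` d7f6f5f4537369e2 (`FrameBrick`: seams `e I hI`, `τ I hI`, `IsChartAction`, invariants ↔
`τ`-fixed); res-L1-w45c-plan-1 NO OBJECTION 2026-08-27T18:26:16Z / 19:44:04Z. [OURS · L1 W4.5c] — NOT a statement
of any manuscript; replaces the role of no printed item; AI-produced, weaker than expert review. Def-free. Prover
res-D-pv-033.)

For any action `ρ` of `⟨σ⟩` on `Spec Aₙ` with the affine-quotient law, `hJ`, any `q : Spec Aₙ ⟶ Y` and
`ρB : ActionOver (π ≫ q) ⟨σ⟩` whose automorphisms are the lifted ones (`haut`), `i ∈ I`, and a stable open `O`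
GIVEN AS A VARIABLE with `hOs : O = O_{i,I}` (keeps the statement small; lead-1's isDefEq lesson 19:43:35Z):
**`exists_pieceSeam`** — the piece `O_{i,I} = D₊(N_{i,I})` is `ρB`-stable (`preimage_normPiece_eq`) and there are the
chart map `β`, a ring isomorphism `e : Γ(O_{i,I}, (O.ι ≫ π ≫ q)⁻¹ ⊤) ≃+* ChartRing k p n i I` and a `k`-algebra map
`τ : M_I →ₐ[k] M_I` with: (i) `e ((O.ι ≫ π)^* r) = β r`; (ii) `e (act σ x) = τ (e x)` and `τ (β r) = β (σ r)`;
(iii) `IsChartAction k p n i I τ`; (iv) `x` invariant ↔ `τ (e x) = e x`. Assembly: `Ω` of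
`BlowupExit.exists_basicOpen_sectionsEquiv` on the invariant norm element (F3c-2b) and `A` of F3c-4b; the laws by
cancellation in the domain `M_I` (`β u_l = s t_l ≠ 0`).
-/

-- single-problem summit: the doubled namespace component `ResolutionOfSingularities` is forced
set_option linter.dupNamespace false

noncomputable section

open CategoryTheory AlgebraicGeometry TopologicalSpace MvPolynomial Polynomial HomogeneousLocalization
open scoped Pointwise
open Literature.AlgebraicGeometry.Resolution Literature.AlgebraicGeometry.RelativeSpec

namespace Summit.ResolutionOfSingularities.ResolutionOfSingularities.Theorems.WildQuotientResolution.ConductorOne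

variable (k : Type) [Field k] (p n : ℕ) [Fact p.Prime] [CharP k p]
  (σ : CoreRing k p n ≃ₐ[k] CoreRing k p n)
  (hσ : ∀ i, σ (coreU k p n i) * (1 + coreU k p n i) = coreU k p n i)
  (i : Fin n) (I : Finset (Fin n))

/-- the Rees generator `uₗ t` -/
local notation3 (prettyPrint := false) "uT" l =>
  reesT (I := Ideal.span (Set.range (coreU k p n))) (coreU k p n l)
    (Ideal.mem_span_range_self (f := coreU k p n) (x := l))
/-- the Rees element `(uᵢ − uₗ) t` -/
local notation3 (prettyPrint := false) "dT" i:max l:max =>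
  reesT (I := Ideal.span (Set.range (coreU k p n))) (coreU k p n i - coreU k p n l)
    (Ideal.sub_mem _ (Ideal.mem_span_range_self (f := coreU k p n) (x := i))
      (Ideal.mem_span_range_self (f := coreU k p n) (x := l)))
/-- the norm factor `(u_l t)^p · w_l` -/
local notation3 (prettyPrint := false) "nT" l =>
  ((uT l) ^ p * algebraMap (CoreRing k p n) (reesAlgebra (Ideal.span (Set.range (coreU k p n))))
    (((isUnit_coreFactor k p n l).unit⁻¹ : (CoreRing k p n)ˣ) : CoreRing k p n))
/-- the norm factor `((uᵢ−u_l) t)^p · wᵢ w_l` -/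
local notation3 (prettyPrint := false) "nDT" i:max l:max =>
  ((dT i l) ^ p * algebraMap (CoreRing k p n) (reesAlgebra (Ideal.span (Set.range (coreU k p n))))
    ((((isUnit_coreFactor k p n i).unit⁻¹ * (isUnit_coreFactor k p n l).unit⁻¹ : (CoreRing k p n)ˣ)) :
      CoreRing k p n))
/-- the norm element `N_{i,I}` -/
local notation3 (prettyPrint := false) "normElt" i:max I:max =>
  ((nT i) * (∏ l ∈ Finset.erase I i, (nT l)) * (∏ l ∈ Finset.univ \ I, (nDT i l)))
/-- the piece `O_{i,I} = D₊(N_{i,I})` -/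
local notation3 (prettyPrint := false) "pieceO" i:max I:max =>
  Proj.basicOpen (reesGrading (Ideal.span (Set.range (coreU k p n)))) (normElt i I)

/-! ## The piece is stable under the automorphisms of `ρB` -/

include hσ in
/-- `O_{i,I} = D₊(N_{i,I})` is stable under every `ρB.aut g` when these are the lifted automorphisms.
[OURS · L1 W4.5c] -/
theorem preimage_normPiece_eq
    (ρ : ↥(Subgroup.zpowers σ) →* Aut (Spec (CommRingCat.of (CoreRing k p n))))
    (hρ : ∀ g : ↥(Subgroup.zpowers σ), (ρ g).hom = Spec.map (CommRingCat.ofHom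
      ((MulSemiringAction.toRingEquiv (↥(Subgroup.zpowers σ)) (CoreRing k p n) g⁻¹ :
        CoreRing k p n ≃+* CoreRing k p n) : CoreRing k p n →+* CoreRing k p n)))
    (hJ : ∀ g : ↥(Subgroup.zpowers σ),
      (affineBlowup.idealSheaf (Ideal.span (Set.range (coreU k p n)))).comap (ρ g).hom =
        affineBlowup.idealSheaf (Ideal.span (Set.range (coreU k p n))))
    {Y : Scheme.{0}} (q : Spec (CommRingCat.of (CoreRing k p n)) ⟶ Y)
    (ρB : ActionOver (affineBlowup.π (Ideal.span (Set.range (coreU k p n))) ≫ q) ↥(Subgroup.zpowers σ))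
    (haut : ∀ g, (ρB.aut g).hom =
      (((affineBlowup.isBlowup (Ideal.span (Set.range (coreU k p n)))).liftAction ρ hJ) g).hom)
    (g : ↥(Subgroup.zpowers σ)) : (ρB.aut g).hom ⁻¹ᵁ (pieceO i I) = (pieceO i I) := by
  rw [basicOpen_normElt_eq]
  have h := preimage_piece_eq k p n σ hσ ρ hρ hJ g i I
  rw [← haut g] at h
  exact h

/-! ## The seam -/

-- the seam engine's statements carry the large literal `ActionOver` binder terms
set_option maxHeartbeats 1600000 in
include hσ in
/-- **THE SEAM OF THE PIECE `O_{i,I}`** (see the module docstring). [OURS · L1 W4.5c] -/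
theorem exists_pieceSeam (hi : i ∈ I)
    (ρ : ↥(Subgroup.zpowers σ) →* Aut (Spec (CommRingCat.of (CoreRing k p n))))
    (hρ : ∀ g : ↥(Subgroup.zpowers σ), (ρ g).hom = Spec.map (CommRingCat.ofHom
      ((MulSemiringAction.toRingEquiv (↥(Subgroup.zpowers σ)) (CoreRing k p n) g⁻¹ :
        CoreRing k p n ≃+* CoreRing k p n) : CoreRing k p n →+* CoreRing k p n)))
    (hJ : ∀ g : ↥(Subgroup.zpowers σ),
      (affineBlowup.idealSheaf (Ideal.span (Set.range (coreU k p n)))).comap (ρ g).hom =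
        affineBlowup.idealSheaf (Ideal.span (Set.range (coreU k p n))))
    {Y : Scheme.{0}} (q : Spec (CommRingCat.of (CoreRing k p n)) ⟶ Y)
    (ρB : ActionOver (affineBlowup.π (Ideal.span (Set.range (coreU k p n))) ≫ q) ↥(Subgroup.zpowers σ))
    (haut : ∀ g, (ρB.aut g).hom =
      (((affineBlowup.isBlowup (Ideal.span (Set.range (coreU k p n)))).liftAction ρ hJ) g).hom)
    (O : (affineBlowup (Ideal.span (Set.range (coreU k p n)))).Opens) (hOs : O = (pieceO i I))
    (hO : ∀ g, (ρB.aut g).hom ⁻¹ᵁ O = O) :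
    ∃ (β : CoreRing k p n →ₐ[k] ChartRing k p n i I)
      (e : Γ((O : Scheme.{0}), (O.ι ≫ affineBlowup.π (Ideal.span (Set.range (coreU k p n))) ≫ q) ⁻¹ᵁ ⊤) ≃+*
        ChartRing k p n i I)
      (τ : ChartRing k p n i I →ₐ[k] ChartRing k p n i I),
      β (coreU k p n i) = chartX k p n i I i ∧
      (∀ l ∈ I.erase i, β (coreU k p n l) * (1 + chartX k p n i I l) = chartX k p n i I i) ∧
      (∀ l ∉ I, β (coreU k p n l) * (1 + chartX k p n i I l) = chartX k p n i I i * chartX k p n i I l) ∧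
      (∀ r : CoreRing k p n,
        e ((O.ι ≫ affineBlowup.π (Ideal.span (Set.range (coreU k p n)))).appLE ⊤
          ((O.ι ≫ affineBlowup.π (Ideal.span (Set.range (coreU k p n))) ≫ q) ⁻¹ᵁ ⊤) le_top
          ((Scheme.ΓSpecIso (CommRingCat.of (CoreRing k p n))).inv r)) = β r) ∧
      (∀ r : CoreRing k p n, τ (β r) = β (σ r)) ∧
      (∀ x, e ((ρB.restrict O hO).act ⟨σ, Subgroup.mem_zpowers σ⟩ ⊤ x) = τ (e x)) ∧
      IsChartAction k p n i I (τ : ChartRing k p n i I →+* ChartRing k p n i I) ∧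
      (∀ x, x ∈ (ρB.restrict O hO).invariantsRing ⊤ ↔ τ (e x) = e x) := by
  haveI : IsDomain (ChartRing k p n i I) := chartRing_isDomain k p n i I
  -- the coefficientwise Rees automorphisms
  obtain ⟨φ, hφ, hf⟩ := BlowupExit.exists_reesGradedHom_family
    (I := Ideal.span (Set.range (coreU k p n))) (G := ↥(Subgroup.zpowers σ)) (smul_coreMaximal_eq k p n σ hσ)
  have hφs : ∀ g : ↥(Subgroup.zpowers σ), φ g (normElt i I) = (normElt i I) :=
    fun g => reesGradedHom_normElt_eq k p n σ hσ φ hφ g i I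
  have hP : ∀ g : ↥(Subgroup.zpowers σ), Submonoid.powers (normElt i I) ≤
      (Submonoid.powers (normElt i I)).comap (φ g) :=
    fun g => powers_normElt_le_comap k p n σ hσ φ hφ g i I
  -- the seam `Ω : (Aₙ[𝔪t])_{(N)} ≃ Γ(O, …)`
  obtain ⟨Ω, hΩbase, hΩact⟩ := BlowupExit.exists_basicOpen_sectionsEquiv ρ hρ hJ q ρB haut (normElt i I)
    (normElt_mem k p n i I) (normElt_deg_pos p n i I) φ hφ hf hφs hP O hO hOs
  -- the algebra `A : (Aₙ[𝔪t])_{(N)} ≃ M_I`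
  obtain ⟨β, A, hβi, hβI', hβO', hβI, hβO, hA⟩ := exists_awayEquiv_chartRing k p n i I hi
  -- the generator and the transported map
  set γ₀ : ↥(Subgroup.zpowers σ) := ⟨σ, Subgroup.mem_zpowers σ⟩ with hγ₀
  let τ₀ : ChartRing k p n i I →+* ChartRing k p n i I :=
    A.toRingHom.comp ((HomogeneousLocalization.map (φ γ₀⁻¹) (hP γ₀⁻¹)).comp A.symm.toRingHom)
  have hτ₀A : ∀ y, τ₀ (A y) = A (HomogeneousLocalization.map (φ γ₀⁻¹) (hP γ₀⁻¹) y) := by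
    intro y
    change A (HomogeneousLocalization.map (φ γ₀⁻¹) (hP γ₀⁻¹) (A.symm (A y))) = _
    rw [A.symm_apply_apply]
  have hτ₀β : ∀ r : CoreRing k p n, τ₀ (β r) = β (σ r) := by
    intro r
    rw [← hA, hτ₀A, BlowupExit.map_base (normElt i I) (φ γ₀⁻¹) _ (hφ γ₀⁻¹) (hP γ₀⁻¹) r, hA]
    congr 1
  let τ : ChartRing k p n i I →ₐ[k] ChartRing k p n i I :=
    { τ₀ with
      commutes' := fun c => by
        change τ₀ (algebraMap k (ChartRing k p n i I) c) = algebraMap k (ChartRing k p n i I) c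
        rw [← β.commutes c, hτ₀β, σ.commutes] }
  have hτ : ∀ x, τ x = τ₀ x := fun x => rfl
  have hτβ : ∀ r : CoreRing k p n, τ (β r) = β (σ r) := fun r => by rw [hτ, hτ₀β]
  -- equivariance for the generator
  have hequi : ∀ x, (Ω.symm.trans A) ((ρB.restrict O hO).act γ₀ ⊤ x) = τ ((Ω.symm.trans A) x) := by
    intro x
    rw [RingEquiv.trans_apply, RingEquiv.trans_apply, hτ, hτ₀A]
    congr 1
    apply Ω.injective
    rw [Ω.apply_symm_apply, ← hΩact, Ω.apply_symm_apply]
  -- `e := Ω⁻¹ ≫ A`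
  refine ⟨β, Ω.symm.trans A, τ, hβi, hβI', hβO', fun r => ?_, fun r => ?_, hequi, ?_, fun x => ?_⟩
  · -- (i)
    rw [RingEquiv.trans_apply, ← hA, ← hΩbase r, Ω.symm_apply_apply]
  · -- τ ∘ β = β ∘ σ
    rw [hτ, hτ₀β]
  · -- the diagonal-Möbius laws
    have hs0 : chartX k p n i I i ≠ 0 := fun h =>
      X_ne_zero i (chart_algebraMap_injective k p n i I (h.trans (map_zero _).symm))
    have htI1 : ∀ l, (1 + chartX k p n i I l) * Ring.inverse (1 + chartX k p n i I l) = 1 :=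
      one_add_chartX_mul_tInv k p n i I hi
    have htI0 : ∀ l, Ring.inverse (1 + chartX k p n i I l) ≠ 0 := fun l h => by
      have := htI1 l; rw [h, mul_zero] at this; exact zero_ne_one this
    have hd : ∀ l, σ (coreU k p n i - coreU k p n l) * ((1 + coreU k p n i) * (1 + coreU k p n l)) =
        coreU k p n i - coreU k p n l := fun l => by
      rw [map_sub]; linear_combination (1 + coreU k p n l) * hσ i - (1 + coreU k p n i) * hσ l
    refine ⟨?_, fun l hl => ?_, fun l hl => ?_⟩
    · -- `τ s · (1 + s) = s`
      change τ (chartX k p n i I i) * (1 + chartX k p n i I i) = chartX k p n i I i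
      rw [← hβi, hτ, hτ₀β, ← map_one β, ← map_add, ← map_mul, hσ i]
    · by_cases hli : l = i
      · subst hli
        change τ (chartX k p n l I l) * (1 + chartX k p n l I l) = chartX k p n l I l
        rw [← hβi, hτ, hτ₀β, ← map_one β, ← map_add, ← map_mul, hσ l]
      have hl' : l ∈ I.erase i := Finset.mem_erase.mpr ⟨hli, hl⟩
      -- from `X_l · βu_l = β(uᵢ − u_l)`: apply `τ`, multiply by `β((1+uᵢ)(1+u_l))`, cancel `β u_l`
      have key := chartX_mul_beta_coreU k p n i I hi β hβi hβI l hl'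
      have key' := congrArg τ key
      simp only [map_mul, hτβ] at key'
      have hne : β (coreU k p n l) ≠ 0 := by rw [hβI l hl']; exact mul_ne_zero hs0 (htI0 l)
      change τ (chartX k p n i I l) * (1 + chartX k p n i I i) = chartX k p n i I l
      refine mul_right_cancel₀ hne ?_
      have e1 : β (σ (coreU k p n l)) * (1 + β (coreU k p n l)) = β (coreU k p n l) := by
        rw [← map_one β, ← map_add, ← map_mul, hσ l]
      have e2 : β (σ (coreU k p n i - coreU k p n l)) * ((1 + chartX k p n i I i) * (1 + β (coreU k p n l))) =
          β (coreU k p n i - coreU k p n l) := by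
        rw [← hβi, ← map_one β, ← map_add, ← map_add, ← map_mul, ← map_mul, hd l]
      calc τ (chartX k p n i I l) * (1 + chartX k p n i I i) * β (coreU k p n l)
          = τ (chartX k p n i I l) * (1 + chartX k p n i I i) * (β (σ (coreU k p n l)) * (1 + β (coreU k p n l))) := by
            rw [e1]
        _ = (τ (chartX k p n i I l) * β (σ (coreU k p n l))) *
            ((1 + chartX k p n i I i) * (1 + β (coreU k p n l))) := by ring
        _ = β (σ (coreU k p n i - coreU k p n l)) * ((1 + chartX k p n i I i) * (1 + β (coreU k p n l))) := by
            rw [key']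
        _ = chartX k p n i I l * β (coreU k p n l) := by rw [e2, key]
    · -- `τ e_l = e_l · (1 + s)` from `X_l · β(uᵢ − u_l) = β u_l`
      have key := chartX_mul_beta_coreDiff k p n i I hi β hβi hβO l hl
      have key' := congrArg τ key
      simp only [map_mul, hτβ] at key'
      have hne : β (coreU k p n i - coreU k p n l) ≠ 0 := by
        rw [beta_coreDiff k p n i I hi β hβi hβO l hl]; exact mul_ne_zero hs0 (htI0 l)
      change τ (chartX k p n i I l) = chartX k p n i I l * (1 + chartX k p n i I i)
      refine mul_right_cancel₀ hne ?_
      have e1 : β (σ (coreU k p n l)) * (1 + β (coreU k p n l)) = β (coreU k p n l) := by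
        rw [← map_one β, ← map_add, ← map_mul, hσ l]
      have e2 : β (σ (coreU k p n i - coreU k p n l)) * ((1 + chartX k p n i I i) * (1 + β (coreU k p n l))) =
          β (coreU k p n i - coreU k p n l) := by
        rw [← hβi, ← map_one β, ← map_add, ← map_add, ← map_mul, ← map_mul, hd l]
      calc τ (chartX k p n i I l) * β (coreU k p n i - coreU k p n l)
          = τ (chartX k p n i I l) * (β (σ (coreU k p n i - coreU k p n l)) *
              ((1 + chartX k p n i I i) * (1 + β (coreU k p n l)))) := by rw [e2]
        _ = (τ (chartX k p n i I l) * β (σ (coreU k p n i - coreU k p n l))) *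
            ((1 + chartX k p n i I i) * (1 + β (coreU k p n l))) := by ring
        _ = β (σ (coreU k p n l)) * ((1 + chartX k p n i I i) * (1 + β (coreU k p n l))) := by rw [key']
        _ = (β (σ (coreU k p n l)) * (1 + β (coreU k p n l))) * (1 + chartX k p n i I i) := by ring
        _ = chartX k p n i I l * β (coreU k p n i - coreU k p n l) * (1 + chartX k p n i I i) := by rw [e1, key]
        _ = chartX k p n i I l * (1 + chartX k p n i I i) * β (coreU k p n i - coreU k p n l) := by ring
  · -- invariants: fixed by the generator iff fixed by all of `⟨σ⟩`
    have hgen : (∀ g : ↥(Subgroup.zpowers σ), (ρB.restrict O hO).act g ⊤ x = x) ↔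
        (ρB.restrict O hO).act γ₀ ⊤ x = x := by
      refine ⟨fun h => h γ₀, fun h g => ?_⟩
      have h1 : (ρB.restrict O hO).act γ₀⁻¹ ⊤ x = x := by
        have h2 := congrArg ((ρB.restrict O hO).act γ₀⁻¹ ⊤) h
        rw [← RingHom.comp_apply, ← ActionOver.act_mul, inv_mul_cancel, ActionOver.act_one,
          RingHom.id_apply] at h2
        exact h2.symm
      obtain ⟨z, hz⟩ := Subgroup.mem_zpowers_iff.mp g.2
      have hg : g = γ₀ ^ z := Subtype.ext (by rw [SubgroupClass.coe_zpow, ← hz])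
      rw [hg]
      clear hg hz
      induction z using Int.induction_on with
      | zero => rw [zpow_zero, ActionOver.act_one]; rfl
      | succ j ih => rw [zpow_add_one, ActionOver.act_mul, RingHom.comp_apply, h, ih]
      | pred j ih => rw [zpow_sub_one, ActionOver.act_mul, RingHom.comp_apply, h1, ih]
    rw [ActionOver.mem_invariantsRing_iff, hgen, ← hequi x]
    exact ⟨fun h => by rw [h], fun h => (Ω.symm.trans A).injective h⟩

end Summit.ResolutionOfSingularities.ResolutionOfSingularities.Theorems.WildQuotientResolution.ConductorOne

end
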